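/-
Copyright (c) 2026 the pub-hodgecm-mathlib formalisation cell (harness21).  Prover seat hodgecm-mathlib-K2E3-p17 (g9), R90-S4 FILE C (deal S4#C-REG2 «ε-REGULARITY HYGIENE», S4 dealer
K2E2-plan (g6) 16:25:08Z): ε-regularity of `δ ∈ G̃_v` is a function of the stable ε-class and reads off any norm `γ ∈ 𝒩(δ)`.  2026-09-04.
-/
import Summits.HodgeConjecture.HodgeConjecture.Theorems.R90S4TwistedTransferDefs     -- ★ `IsEpsRegularAt`, `IsStablyEpsConjAt`, `IsStablyConjGAt` (brings ★ `R90S4TwistedNormMapLocal`, ★ `R90S4TwistedNormMap`, ★ `LocalTransfer`)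
import HarnessLib

/-!
# R90-S4 FILE C — ε-REGULARITY IS A STABLE ε-CLASS FUNCTION AND IS READ OFF THE NORM [Rogawski §3.1 p. 19, §3.11 p. 34]

Cell `hodgecm-mathlib`, programme R90-TF, section S4 «Ch13-main» FILE C (twisted transfer `G̃_v ⇝ G_v`), deal S4#C-REG2 BY NAME; THEOREMS ONLY (no definition, no named fact,
no `sorry`); count-neutral helper (`--supports stmt-HodgeConjecture-24833 --as helper`).

`δ ∈ G̃_v = GL₃(L ⊗ L⁺_v)` is ε-REGULAR (★ `IsEpsRegularAt L Φ v δ`) iff its norm `N(δ) = δ ε_v(δ)` is regular semisimple (★ `IsRegularElt`: separable characteristic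
polynomial).  Since regularity is a class function (★ `isRegularElt_of_isConj`), and stable ε-conjugacy ∕ «`γ ∈ 𝒩(δ)`» ∕ stable conjugacy in `G_v` are all
CONJUGACY OF NORMS in `G̃_v` (★ `IsStablyEpsConjAt`, ★ `IsEpsNormPair`, ★ `IsStablyConjGAt`), every statement below is a one-line transport:
* §1 (a) `IsEpsRegularAt` is invariant under stable ε-conjugacy (`isEpsRegularAt_iff_of_isStablyEpsConjAt`), under ε-conjugacy for hermitian `Φ`
  (`isStablyEpsConjAt_of_isEpsConj`, `isEpsRegularAt_iff_of_isEpsConj`, `isEpsRegularAt_mul_mul_epsLoc_inv_iff`);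
* §2 (b) «`δ` is ε-regular iff its norms are regular»: `isEpsRegularAt_iff_isRegularElt_of_isEpsNormPair` (`γ ∈ 𝒩(δ)` ⇒ (`δ` ε-regular ⇔ `γ` regular)), regularity on `G_v` is a
  stable-class function (`isRegularElt_iff_of_isStablyConjGAt`), and `γ ∈ G_v ⊂ G̃_v` is ε-regular iff `γ²` is regular (`isEpsRegularAt_coe_iff_isRegularElt_sq`);
* §3 (c, the ★ half) `G̃_{δε} ≤ G̃_{N(δ)}` at `ε_v = epsLoc` (`epsCentralizer_epsLoc_le_centralizer_epsNorm`) and, through a norm `γ ∈ 𝒩(δ)`, `G̃_{δε}` is conjugate INTO the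
  centraliser of `γ` (`exists_epsCentralizer_le_centralizer_conj_of_isEpsNormPair`).  «The centraliser of a regular semisimple element of `GL₃` is commutative» is NOT in the
  tree (census) and is not claimed.
[cite: Rogawski1990, §3.1 p. 19; §3.11 Prop. 3.11.1 (c) p. 34; §1.4 p. 4]

HONEST LABEL: hygiene organs for FILE C; HC_CM is proved only modulo the 7 printed citations (2 remaining named inputs: hLiu418 = stmt-HodgeConjecture-24832, h413 =
stmt-HodgeConjecture-24833) until rung 0 closes; count-neutral.
-/

set_option autoImplicit false
set_option linter.dupNamespace false

noncomputable section

open scoped NumberField MatrixGroups Matrix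

namespace Summit.HodgeConjecture.HodgeConjecture.R90.S4

open Literature.NumberTheory.Rogawski1990
open Literature.NumberTheory.Rogawski1990.Ch4Sec10
open Literature.NumberTheory.Automorphic
open IsDedekindDomain NumberField

variable {L : Type} [Field L] [NumberField L] [IsCMField L] {Φ : GL (Fin 3) L} {v : HeightOneSpectrum (𝓞 ↥(maximalRealSubfield L))}

/-! ## §1 (a) ε-regularity is a stable ε-class function -/

/-- **ε-regularity is invariant under stable ε-conjugacy** (conjugate norms have the same characteristic polynomial). [cite: Rogawski1990, §3.11 p. 34; §3.1 p. 19] -/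
theorem IsEpsRegularAt.of_isStablyEpsConjAt {δ δ' : GtLoc L v} (h : IsStablyEpsConjAt L Φ v δ δ') (hδ : IsEpsRegularAt L Φ v δ) :
    IsEpsRegularAt L Φ v δ' :=
  isRegularElt_of_isConj h hδ

/-- `IsEpsRegularAt L Φ v δ ↔ IsEpsRegularAt L Φ v δ′` for stably ε-conjugate `δ, δ′`. [cite: Rogawski1990, §3.11 p. 34; §3.1 p. 19] -/
theorem isEpsRegularAt_iff_of_isStablyEpsConjAt {δ δ' : GtLoc L v} (h : IsStablyEpsConjAt L Φ v δ δ') :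
    IsEpsRegularAt L Φ v δ ↔ IsEpsRegularAt L Φ v δ' :=
  ⟨fun hδ => hδ.of_isStablyEpsConjAt h, fun hδ' => hδ'.of_isStablyEpsConjAt h.symm⟩

/-- **ε-conjugate elements are stably ε-conjugate** (hermitian `Φ`, so that `ε_v ∘ ε_v = id`: ★ `isConj_epsNorm_epsLoc_of_isEpsConj`). [cite: Rogawski1990, §3.11 Prop. 3.11.1 (c) p. 34] -/
theorem isStablyEpsConjAt_of_isEpsConj (hΦ : ((Φ : GL (Fin 3) L) : Matrix (Fin 3) (Fin 3) L)ᵀ.map (IsCMField.complexConj L) = (Φ : Matrix (Fin 3) (Fin 3) L))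
    {δ δ' : GtLoc L v} (hc : IsEpsConj (epsLoc L Φ v) δ δ') : IsStablyEpsConjAt L Φ v δ δ' :=
  isConj_epsNorm_epsLoc_of_isEpsConj hΦ hc

/-- **ε-regularity is invariant under ε-conjugacy** (hermitian `Φ`). [cite: Rogawski1990, §3.11 p. 34; §1.4 p. 4] -/
theorem IsEpsRegularAt.of_isEpsConj (hΦ : ((Φ : GL (Fin 3) L) : Matrix (Fin 3) (Fin 3) L)ᵀ.map (IsCMField.complexConj L) = (Φ : Matrix (Fin 3) (Fin 3) L))
    {δ δ' : GtLoc L v} (hc : IsEpsConj (epsLoc L Φ v) δ δ') (hδ : IsEpsRegularAt L Φ v δ) : IsEpsRegularAt L Φ v δ' :=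
  hδ.of_isStablyEpsConjAt (isStablyEpsConjAt_of_isEpsConj hΦ hc)

/-- `IsEpsRegularAt L Φ v δ ↔ IsEpsRegularAt L Φ v δ′` for ε-conjugate `δ, δ′` (hermitian `Φ`). [cite: Rogawski1990, §3.11 p. 34; §1.4 p. 4] -/
theorem isEpsRegularAt_iff_of_isEpsConj (hΦ : ((Φ : GL (Fin 3) L) : Matrix (Fin 3) (Fin 3) L)ᵀ.map (IsCMField.complexConj L) = (Φ : Matrix (Fin 3) (Fin 3) L))
    {δ δ' : GtLoc L v} (hc : IsEpsConj (epsLoc L Φ v) δ δ') : IsEpsRegularAt L Φ v δ ↔ IsEpsRegularAt L Φ v δ' :=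
  isEpsRegularAt_iff_of_isStablyEpsConjAt (isStablyEpsConjAt_of_isEpsConj hΦ hc)

/-- The explicit ε-conjugate `y δ ε_v(y)⁻¹` is ε-regular iff `δ` is (hermitian `Φ`). [cite: Rogawski1990, §3.11 p. 34; §1.4 p. 4] -/
theorem isEpsRegularAt_mul_mul_epsLoc_inv_iff (hΦ : ((Φ : GL (Fin 3) L) : Matrix (Fin 3) (Fin 3) L)ᵀ.map (IsCMField.complexConj L) = (Φ : Matrix (Fin 3) (Fin 3) L))
    (y δ : GtLoc L v) : IsEpsRegularAt L Φ v (y * δ * (epsLoc L Φ v y)⁻¹) ↔ IsEpsRegularAt L Φ v δ :=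
  (isEpsRegularAt_iff_of_isEpsConj hΦ (⟨y, rfl⟩ : IsEpsConj (epsLoc L Φ v) δ (y * δ * (epsLoc L Φ v y)⁻¹))).symm

/-! ## §2 (b) ε-regularity is read off the norm -/

/-- **«`δ` is ε-regular iff its norms are regular»**: for `γ ∈ 𝒩(δ)` (★ `IsEpsNormPair`: `N(δ)` conjugate to `γ` in `G̃_v`), `δ` is ε-regular iff `γ` is regular semisimple in
`G̃_v`. [cite: Rogawski1990, §3.11 p. 34; §3.1 p. 19] -/
theorem isEpsRegularAt_iff_isRegularElt_of_isEpsNormPair {δ : GtLoc L v} {γ : (UnitaryGroup.cmDatum L 3 (Φ : Matrix (Fin 3) (Fin 3) L)).Local v}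
    (h : IsEpsNormPair L Φ v δ γ) : IsEpsRegularAt L Φ v δ ↔ IsRegularElt (γ.val : GtLoc L v) :=
  ⟨fun hδ => isRegularElt_of_isConj h hδ, fun hγ => isRegularElt_of_isConj h.symm hγ⟩

/-- A norm of an ε-regular element is regular. [cite: Rogawski1990, §3.11 p. 34] -/
theorem IsEpsRegularAt.isRegularElt_of_isEpsNormPair {δ : GtLoc L v} {γ : (UnitaryGroup.cmDatum L 3 (Φ : Matrix (Fin 3) (Fin 3) L)).Local v}
    (hδ : IsEpsRegularAt L Φ v δ) (h : IsEpsNormPair L Φ v δ γ) : IsRegularElt (γ.val : GtLoc L v) :=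
  (isEpsRegularAt_iff_isRegularElt_of_isEpsNormPair h).1 hδ

/-- An element with a regular norm is ε-regular. [cite: Rogawski1990, §3.11 p. 34] -/
theorem isEpsRegularAt_of_isEpsNormPair_of_isRegularElt {δ : GtLoc L v} {γ : (UnitaryGroup.cmDatum L 3 (Φ : Matrix (Fin 3) (Fin 3) L)).Local v}
    (h : IsEpsNormPair L Φ v δ γ) (hγ : IsRegularElt (γ.val : GtLoc L v)) : IsEpsRegularAt L Φ v δ :=
  (isEpsRegularAt_iff_isRegularElt_of_isEpsNormPair h).2 hγ

/-- **Regularity on `G_v` is a stable-class function** (★ `IsStablyConjGAt` = conjugacy in `G̃_v`). [cite: Rogawski1990, §3.1 p. 19] -/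
theorem isRegularElt_iff_of_isStablyConjGAt {γ γ' : (UnitaryGroup.cmDatum L 3 (Φ : Matrix (Fin 3) (Fin 3) L)).Local v} (h : IsStablyConjGAt L Φ v γ γ') :
    IsRegularElt (γ.val : GtLoc L v) ↔ IsRegularElt (γ'.val : GtLoc L v) :=
  ⟨fun hγ => isRegularElt_of_isConj h hγ, fun hγ' => isRegularElt_of_isConj h.symm hγ'⟩

/-- **`γ ∈ G_v ⊂ G̃_v` is ε-regular iff `γ²` is regular** (`N(γ) = γ²`, ★ `isEpsNormPair_sq`). [cite: Rogawski1990, §3.11 p. 34] -/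
theorem isEpsRegularAt_coe_iff_isRegularElt_sq (γ : (UnitaryGroup.cmDatum L 3 (Φ : Matrix (Fin 3) (Fin 3) L)).Local v) :
    IsEpsRegularAt L Φ v (γ.val : GtLoc L v) ↔ IsRegularElt ((γ * γ).val : GtLoc L v) :=
  isEpsRegularAt_iff_isRegularElt_of_isEpsNormPair (isEpsNormPair_sq γ)

/-- Two elements with a common norm are ε-regular together. [cite: Rogawski1990, §3.11 Prop. 3.11.1 (c) p. 34] -/
theorem isEpsRegularAt_iff_of_isEpsNormPair_of_isEpsNormPair {δ δ' : GtLoc L v} {γ : (UnitaryGroup.cmDatum L 3 (Φ : Matrix (Fin 3) (Fin 3) L)).Local v}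
    (h : IsEpsNormPair L Φ v δ γ) (h' : IsEpsNormPair L Φ v δ' γ) : IsEpsRegularAt L Φ v δ ↔ IsEpsRegularAt L Φ v δ' :=
  isEpsRegularAt_iff_of_isStablyEpsConjAt (isStablyEpsConjAt_of_isEpsNormPair h h')

/-! ## §3 (c) the ε-centraliser sits inside the centraliser of the norm -/

/-- **(3.10.1) at `ε_v = epsLoc`: `G̃_{δε} ≤ G̃_{N(δ)}`** (hermitian `Φ`; ★ `epsCentralizer_le_centralizer_epsNorm`). [cite: Rogawski1990, §3.10 (3.10.1) p. 33; §3.11 p. 34] -/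
theorem epsCentralizer_epsLoc_le_centralizer_epsNorm (hΦ : ((Φ : GL (Fin 3) L) : Matrix (Fin 3) (Fin 3) L)ᵀ.map (IsCMField.complexConj L) = (Φ : Matrix (Fin 3) (Fin 3) L))
    (δ : GtLoc L v) : epsCentralizer (epsLoc L Φ v) δ ≤ Subgroup.centralizer {epsNorm (epsLoc L Φ v) δ} :=
  epsCentralizer_le_centralizer_epsNorm (epsLoc L Φ v) (twistLocal_twistLocal_cm L 3 Φ hΦ v) δ

/-- **Through a norm `γ ∈ 𝒩(δ)` the ε-centraliser is conjugate INTO the centraliser of `γ`**: there is `x ∈ G̃_v` with `x G̃_{δε} x⁻¹ ≤ G̃_γ` — i.e. every `g ∈ G̃_{δε}`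
satisfies `(x g x⁻¹) γ = γ (x g x⁻¹)` (hermitian `Φ`).  At ε-regular `δ`, `γ` is regular semisimple (§2), whose centraliser is a maximal torus; that last fact is not in the
tree and is not claimed. [cite: Rogawski1990, §3.10 (3.10.1) p. 33; §3.11 p. 34] -/
theorem exists_epsCentralizer_le_centralizer_conj_of_isEpsNormPair (hΦ : ((Φ : GL (Fin 3) L) : Matrix (Fin 3) (Fin 3) L)ᵀ.map (IsCMField.complexConj L) = (Φ : Matrix (Fin 3) (Fin 3) L))
    {δ : GtLoc L v} {γ : (UnitaryGroup.cmDatum L 3 (Φ : Matrix (Fin 3) (Fin 3) L)).Local v} (h : IsEpsNormPair L Φ v δ γ) :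
    ∃ x : GtLoc L v, ∀ g ∈ epsCentralizer (epsLoc L Φ v) δ, x * g * x⁻¹ * (γ.val : GtLoc L v) = (γ.val : GtLoc L v) * (x * g * x⁻¹) := by
  obtain ⟨c, hc⟩ := isConj_iff.mp h
  refine ⟨c, fun g hg => ?_⟩
  have hcomm : g * epsNorm (epsLoc L Φ v) δ = epsNorm (epsLoc L Φ v) δ * g :=
    Subgroup.mem_centralizer_singleton_iff.1 (epsCentralizer_epsLoc_le_centralizer_epsNorm hΦ δ hg)
  rw [← hc]
  calc c * g * c⁻¹ * (c * epsNorm (epsLoc L Φ v) δ * c⁻¹)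
      = c * (g * epsNorm (epsLoc L Φ v) δ) * c⁻¹ := by group
    _ = c * (epsNorm (epsLoc L Φ v) δ * g) * c⁻¹ := by rw [hcomm]
    _ = c * epsNorm (epsLoc L Φ v) δ * c⁻¹ * (c * g * c⁻¹) := by group

end Summit.HodgeConjecture.HodgeConjecture.R90.S4

end
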